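/- Copyright: the b2b-balaban cell (near-miss cell 7), T⁴-continuum fan-out, row NE7b CRUX team (2), seat
`t4-ne7b-formalise-leaf-06` (gen 144) — third-named typist's build of the OWNER's INTERFACE REQUEST NE7b IR-103-2 (b) «THE END AT THE TOWER,
COUNT DERIVED» (OWNER `t4-ne7b-p1` g103, rulings W-ne7bp1-g103-4 C-4 ∕ W-ne7bp1-g103-5 (2); memo `t4/b2b-balaban-t4-ne7b-p1/g103/F-RHO-TOWER-g103.md`
§7 REFINED (b) + CORRECTION), part 1 of 2: the record.  Released under the licence of the surrounding project. -/
import Summits.QuantumFields.BalabanUV.T4Continuum.Support.B16HistoryTowerExtractionDataLWR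

/-!
# (α)-INSTANCE — THE END AT THE TOWER, COUNT DERIVED, part 1: the record `TowerExtractionPricedDataLWR` = IR-103-1's
`TowerExtractionDataLWR` (p354906) MINUS the cell's COUNT block, PLUS the two runs' PRICE SENTENCES per pinned old genealogy

Summits-side support leaf of the T⁴-continuum cell (rung (B)+1 on a FINITE torus only; NOT infinite volume, NOT the mass gap, NOT
Clay; NOT a proof of NE7b — the cell's OWN estimate `T4WeightBudget.RelWeightBound`, NOT PRINTED, NOT PROVED).  [folklore] ONE
`structure` (a hypothesis SHAPE: data + located displays + C-side letters, NOTHING of Bałaban's asserted); no `[cite:]` tag, no `Prop`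
minted, zero `sorry`.  INTERFACE REQUEST NE7b IR-103-2 (b) (OWNER `t4-ne7b-p1` g103; typist leaf-06 g144, INTENT I-leaf06-g144-1, journal
l.51194 — third-named after leaf-03 ∕ leaf-01); part 2 (`B16HistoryTowerExtractionEnd2`) carries the pinned `_rel` END and the road
`continuumYM4Torus_of_towerExtractionPriced_fsc`.  IR-103-1's record ∕ road (`TowerExtractionDataLWR`, `continuumYM4Torus_of_towerExtraction_fsc`:
count DISPLAYED) stay in the tree as the terminal theorem of record of the re-cut (α) road until the OWNER says otherwise.

WHY (the OWNER's memo §7 REFINED (b) and ruling W-ne7bp1-g103-5 (2); zero weight on rank ∕ price).  IR-103-1 re-cut the (α) road at the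
per-pinned-class RELATIVE display `extractA ∕ extractB` and DISPLAYED the cell's count `Σ_{k bad} q K k ≤ V · rq ^ (K − jhalf K)` as two
record rows (`countA ∕ countB`, task T-g103-1 of the count's custodians).  The count is the CELL's banking arithmetic, and the cell's PRICE
road already derives it — in print's currency, per term, from the per-member shape prices `pshapeTH` (the multiplicity-socket levels
`HistoryAssemblyRealiseRunMultPWT` → `HistoryRealiseCellsRunMultEndPDWTL` of the 2R tower road).  The OWNER re-cut those levels at the
relative display (IR-103-0 `Spine/NE7b/TreeBindersRel` p354247, IR-103-2 L1 `TermReadingRel` p354853, leaf-01 g77's P∕W∕T twins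
`RealisedRunRelPWT` p356585 → `RealisedDomainsRelPWT` → `RealisedEndRelPWT` → `RealisedEndRelPDWTL`), whose END reads, in place of the
(B)-side rows, the envelopes and the term-wise numerator rows, exactly: the weights' signs, ONE relative quotient per physical member-key
family (`hqA ∕ hqB`), THE TWO RELATIVE DISPLAYS (`fibM ∕ fibM′`) and THE PRICE SENTENCES at that quotient (`hPq ∕ hPq′`).  THIS RECORD is
that END's input shape at the tower: IR-103-1's record with the count block STRUCK and the price sentences ADDED — «the relative weight of
a pinned live key family is at most its PRINTED PRICE», H3^NE7b in its final honest form (memo §7).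

INDEX CONVENTION (C-ρ-TOWER, ruling W-ne7bp1-g103-2 (1); words, no field): as IR-103-1 — the tower is read AT PRINT's LIVE INDEX; the
second-group 𝐑-outputs and healings of step `j` are folded into `(T K).op j g p` ((1.98) ∕ (1.101), EXPONENTIATED so that the operations
stay positive, design note N-ne7bp1-g103-2); on read terms `histV.died j = ∅` by construction.

WHAT.  `TowerExtractionDataLWR` FIELD FOR FIELD (same parameter block `(D C O θv rr d n hn g₀ os cΛ M Φ β₀ p₁ η η' κ κ₂ κᵥ P X 𝒢 μ)`,
same order, same binder shapes) with:
* STRUCK (the cell's COUNT block, DERIVED by part 2's road): `V rq hV hrq0 hrq1 countA countB`;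
* KEPT VERBATIM: the quotients `qA qB` with `qA_nonneg ∕ qB_nonneg` (= the `_rel` END's `hqA ∕ hqB` at the tower) and **`extractA ∕
  extractB`** (= the `_rel` END's `fibM` at the tower letter for letter — `memA ∕ kmemA` unfold to `memOf ∕ kmemOf` at
  `ped := (𝒮.reading T p₀).inputOf.pedV`, `cellP := fun _ _ => id`, `liveC := ….liveCV`, `R := 𝒮.R` —, and run B's display in the
  ruling's run-B-TERMS form, which part 2 moves to the `_rel` END's `fibM′` over `weightB μ RA trunc` by `B16HistoryIndexedTrunc.sum_fibre_aggW_eq`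
  ∕ `sum_aggW_eq (htr K hK)`);
* ADDED: **`priceA ∕ priceB`** — the `_rel` END's price sentences `hPq ∕ hPq′` at the tower, `κ = κ′ := costT Prod.fst C K (𝒮.R K)` (so the
  END's realised-cost rows `hκ ∕ hκ′` are `le_rfl`), VERBATIM the memo §7 (b);
* every other field KEPT VERBATIM (ruling W-ne7bp1-g103-1 §4 (3)(i): `intA H2A 𝒮 …`, the flow rows, print's per-step sentences — they
  feed NE7 ∕ NE7c and the identification —, `shell`, `budget`, constants); `Φ ∕ hΦ`, `c Xs hdisp hclass hΩ hcube`, the letter tables and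
  the census identities are DISPLAYED ONLY on this road (the 2R plugs that read them — M5-2e's volume ledger, the rounding junction — are
  not on the `_rel` road), kept so that the parameter block and the suppliers' sockets stay the four sibling records'.
ROAD-READ ∕ DISPLAYED-ONLY.  Part 2's road reads: `l₀ vol l₀_pos vol_pos K₀ T p₀ hp₀ ρ₀ hρ₀ h0 intA H2A 𝒮 hL hs hν hRm hRmS hRm2 isRj
one_le_R hL4 hprof hdrop hD hreg trunc htr qA qB qA_nonneg qB_nonneg extractA extractB priceA priceB shA shB Wsh shell Cc … s budget sum_r
sum_u sum_s sum_s₂` (and `hn`, `F.L` through the key family); every other row is DISPLAYED ONLY — carried for NE7's budget suppliers, NE7c's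
shell suppliers and the (A1c) identification, none of which is here.  The END's constants-side and flow-side binders (`ThresholdOK`, `hμ`,
`hκ₁`, `hE₀`, `1 ≤ A₀`, `0 < β₀`, `L·β₀ ≤ 1`, `13 ≤ n₁`, the class-linear slack `C.a + θ ≤ ½γ₀A₁²`, row S6g′'s `sS ∕ θc` arithmetic) are
NOT record rows: they re-enter part 2's terminal theorem as binders, as in 2R (memo §7 (b) «the constants re-enter the terminal theorem»).
HONEST SCOPE: HYPOTHESES over an ABSTRACT tower family; nothing discharged; what the (A1c) instance OWES of Bałaban's KIND is exactly
`extractA ∕ extractB` + `priceA ∕ priceB` per pinned class (H3^NE7b relocated from terms to partial sums — NOT in print: print never pins a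
genealogy) + the identification; ρ UNVALUED; NEEDS-CONSTANT 0; NE7b NOT proved; spine 0∕9.
HONEST DEPENDENCY (cell): continuum YM on T⁴ ⇐ BetaPertH ∧ nine spine estimates (0/9 proved); BetaPertH ⇐ (D1) ∧ (D4) ∧ CAP+tail;
G-an2-4 gates asym, D1 and NE2/3/4.  Unchanged.
-/
open Finset MeasureTheory
open Literature.MathematicalPhysics.QuantumFieldTheory.Balaban1983to89
open T4PersistenceDictionary T4PersistentHistoryCount T4BankedInduction T4PrintedShapeBanking
open T4WeightBudget T4GlobalDenominator T4LiveClassFibration T4LiveStructureGas T4LiveGasToTerms T4RecordPriceSeam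
open T4PartnerMultiplicity T4IndicatorShell T4MatchingAssembly T4MatchingClosure T4MatchingClosureSocket T4Continuum
open T4StabilitySocket T4BranchingRecordsGas T4TaggedShapeBanking T4CanonicalMenus T4RenewalChains
open Summit.QuantumFields.BalabanUV.T4Continuum.PlacementBatch Summit.QuantumFields.BalabanUV.T4Continuum.PlacementSkeleton
open Summit.QuantumFields.BalabanUV.T4Continuum.CountThresholdUniform Summit.QuantumFields.BalabanUV.T4Continuum.CountThresholdExit
open Summit.QuantumFields.BalabanUV.T4Continuum.CountSeamJunction Summit.QuantumFields.BalabanUV.T4Continuum.LateMergers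
open Summit.QuantumFields.BalabanUV.T4Continuum.HistoryFlow Summit.QuantumFields.BalabanUV.T4Continuum.HistoryRegeneration
open Summit.QuantumFields.BalabanUV.T4Continuum.HistoryTables Summit.QuantumFields.BalabanUV.T4Continuum.HistoryAssemblyTrees
open Summit.QuantumFields.BalabanUV.T4Continuum.HistoryAssemblyTerms Summit.QuantumFields.BalabanUV.T4Continuum.HistoryAssemblyPedigree
open Summit.QuantumFields.BalabanUV.T4Continuum.HistoryConstants Summit.QuantumFields.BalabanUV.T4Continuum.HistoryGen
open Literature.MathematicalPhysics.QuantumFieldTheory.Balaban1983to89.B13ScaleTransfer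
open Summit.QuantumFields.BalabanUV.T4Continuum.ZoneSkeleton Summit.QuantumFields.BalabanUV.T4Continuum.HistorySocketTH
open Summit.QuantumFields.BalabanUV.T4Continuum.HistoryCaps Summit.QuantumFields.BalabanUV.T4Continuum.HistoryAssemblyPrice
open Summit.QuantumFields.BalabanUV.T4Continuum.HistoryBankingLE Summit.QuantumFields.BalabanUV.T4Continuum.HistoryExitLE
open Summit.QuantumFields.BalabanUV.T4Continuum.HistoryAssemblyTreesLE Summit.QuantumFields.BalabanUV.T4Continuum.HistoryAssemblyTermsLE
open Summit.QuantumFields.BalabanUV.T4Continuum.HistoryRealise Summit.QuantumFields.BalabanUV.T4Continuum.HistoryAssemblyRealiseLE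
open Summit.QuantumFields.BalabanUV.T4Continuum.HistoryAssemblyMult Summit.QuantumFields.BalabanUV.T4Continuum.HistoryAssemblyMultKey
open Summit.QuantumFields.BalabanUV.T4Continuum.HistoryAssemblyRealiseRun Summit.QuantumFields.BalabanUV.T4Continuum.HistoryAssemblyRealiseMult
open Summit.QuantumFields.BalabanUV.T4Continuum.HistoryZones Summit.QuantumFields.BalabanUV.T4Continuum.HistoryRealiseCells
open Summit.QuantumFields.BalabanUV.T4Continuum.HistoryRealiseCellsRun Summit.QuantumFields.BalabanUV.T4Continuum.HistoryAssemblyRealiseRunMult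
open Summit.QuantumFields.BalabanUV.T4Continuum.HistoryRealiseCellsRunMult Summit.QuantumFields.BalabanUV.T4Continuum.HistoryAssemblyMultInstance
open Summit.QuantumFields.BalabanUV.T4Continuum.HistoryJoinsPlacedMember Summit.QuantumFields.BalabanUV.T4Continuum.PlacementSkeleton
open Summit.QuantumFields.BalabanUV.T4Continuum.HistoryJoinsPlacedMult Summit.QuantumFields.BalabanUV.T4Continuum.HistoryRealiseDistinct
open Summit.QuantumFields.BalabanUV.T4Continuum.HistoryRegionTemplates Summit.QuantumFields.BalabanUV.T4Continuum.HistoryCaps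
open Summit.QuantumFields.BalabanUV.T4Continuum.HistoryZoneEvolve (cth)
open Literature.MathematicalPhysics.QuantumFieldTheory.Balaban1983to89.B16SProfile (DropCtl)
open Summit.QuantumFields.BalabanUV.T4Continuum.HistoryRealiseCellsRunMultEnd Summit.QuantumFields.BalabanUV.T4Continuum.HistoryRealiseCellsRunMultEndD
open Summit.QuantumFields.BalabanUV.T4Continuum.HistoryRealiseCellsRunPinnedT3b Summit.QuantumFields.BalabanUV.T4Continuum.HistoryHybridRescale
open Summit.QuantumFields.BalabanUV.T4Continuum.HistoryRealiseCellsRunApex (exists_const_schemeZ)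
open Summit.QuantumFields.BalabanUV.T4Continuum.HistoryRealisePrint Summit.QuantumFields.BalabanUV.T4Continuum.HistoryRealiseWeak
open Summit.QuantumFields.BalabanUV.T4Continuum.HistoryRealisePrintReading Summit.QuantumFields.BalabanUV.T4Continuum.HistoryRealiseWeakReading
open Summit.QuantumFields.BalabanUV.T4Continuum.HistoryRealisePrintCells Summit.QuantumFields.BalabanUV.T4Continuum.HistoryRealiseWeakCells
open Summit.QuantumFields.BalabanUV.T4Continuum.HistoryRealiseCellsRunApexT3b Summit.QuantumFields.BalabanUV.T4Continuum.HistoryRealiseCellsRunApexT3bW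
open Summit.QuantumFields.BalabanUV.T4Continuum.HistoryRealiseCellsRunApexT3bWT Summit.QuantumFields.BalabanUV.T4Continuum.HistoryRealiseCellsRunPinnedT3bWT
open Summit.QuantumFields.BalabanUV.T4Continuum.HistoryRealiseCellsRunHeadlineT3bWT
open Summit.QuantumFields.BalabanUV.T4Continuum.HistoryRealiseCellsRunApexT3bWTV Summit.QuantumFields.BalabanUV.T4Continuum.HistoryBankingVolumePlug
open Summit.QuantumFields.BalabanUV.T4Continuum.HistoryRealiseCellsRunApexT3bWTVS
open Summit.QuantumFields.BalabanUV.T4Continuum.HistoryGenealogyRealise Summit.QuantumFields.BalabanUV.T4Continuum.HistoryGenealogyInstantiate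
open Summit.QuantumFields.BalabanUV.T4Continuum.B16HistoryIndexedRepr Summit.QuantumFields.BalabanUV.T4Continuum.B16HistoryIndexedTrunc
open Summit.QuantumFields.BalabanUV.T4Continuum.HistoryBankingDiscountCharge Summit.QuantumFields.BalabanUV.T4Continuum.HistoryBankingCreditRead
open Summit.QuantumFields.BalabanUV.T4Continuum.HistoryBankingFibreRoom Summit.QuantumFields.BalabanUV.T4Continuum.HistoryPriceKeys
open Summit.QuantumFields.BalabanUV.T4Continuum.HistoryRealiseCellsRunSupplyWTVS Summit.QuantumFields.BalabanUV.T4Continuum.HistoryRealiseCellsRunSupplyKeysWTVS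
open Summit.QuantumFields.BalabanUV.T4Continuum.HistoryRealiseCellsRunAssemblyWTVSData Summit.QuantumFields.BalabanUV.T4Continuum.HistoryRealiseCellsRunAssemblyWTVSDataL
open Summit.QuantumFields.BalabanUV.T4Continuum.HistoryBankingSharpShares (sBsharp ell)
open Summit.QuantumFields.BalabanUV.T4Continuum.HistoryBankingRoundingUnrounded (sRunr ApFlat)
open Summit.QuantumFields.BalabanUV.T4Continuum.HistoryBankingVolumeWindowLattice (uvolL)
open Literature.MathematicalPhysics.QuantumFieldTheory.Balaban1983to89.TreeLength Literature.MathematicalPhysics.QuantumFieldTheory.Balaban1983to89.B16MergeGeometry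
open Summit.QuantumFields.BalabanUV.T4Continuum.HistoryAdmissible Summit.QuantumFields.BalabanUV.T4Continuum.HistoryGenealogyExtraction
open Summit.QuantumFields.BalabanUV.T4Continuum.HistoryGenealogyPedigree Summit.QuantumFields.BalabanUV.T4Continuum.HistoryTouchComponents
open Summit.QuantumFields.BalabanUV.T4Continuum.B16HistoryReprChain Summit.QuantumFields.BalabanUV.T4Continuum.B16HistoryReprInstance
open Summit.QuantumFields.BalabanUV.T4Continuum.B16HistoryReprRead Summit.QuantumFields.BalabanUV.T4Continuum.B16HistoryReprReadCausal
open Summit.QuantumFields.BalabanUV.T4Continuum.B16HistoryStepDisplayPinned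
open Summit.QuantumFields.BalabanUV.T4Continuum.B16HistoryTowerEndDataLWL
open Literature.MathematicalPhysics.QuantumFieldTheory.Balaban1983to89.B16StepFactorsPrinted
open Literature.MathematicalPhysics.QuantumFieldTheory.Balaban1983to89.B16LargeFieldFactors380 (minConst)
open Summit.QuantumFields.BalabanUV.T4Continuum.B16HistoryStepJunction
open Summit.QuantumFields.BalabanUV.T4Continuum.B16HistoryTowerEndDataLWR
open Summit.QuantumFields.BalabanUV.T4Continuum.B16HistoryTowerEndPrinted
open Summit.QuantumFields.BalabanUV.T4Continuum.HistoryBankingSharpShares (ell)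
open Summit.QuantumFields.BalabanUV.T4Continuum.B16HistoryTowerEndPrintedR
open Summit.QuantumFields.BalabanUV.T4Continuum.B16HistoryTowerEndPrintedRRange

open Summit.QuantumFields.BalabanUV.T4Continuum.B16HistoryTowerStepRangeDataLWR

namespace Summit.QuantumFields.BalabanUV.T4Continuum.B16HistoryTowerExtractionPricedDataLWR

noncomputable section

set_option synthInstance.maxSize 1024

/-! ## §1 The record -/

section Data

variable {F : T4Family} {G : Type*} [GaugeGroup G] [MeasurableSpace G] [HaarData G] [RegularGaugeGroup G]

/-- **THE INPUTS OF THE (α) ASSEMBLY AT THE TOWER, COUNT DERIVED, BOTH RUNS FROM ONE TOWER FAMILY READ AT PRINT's LIVE INDEX**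
(HYPOTHESIS SHAPE — data + located displays + C-side letters, NOTHING of Bałaban's asserted): IR-103-1's `TowerExtractionDataLWR` with the
cell's COUNT block `V rq hV hrq0 hrq1 countA countB` STRUCK and the two runs' PRICE SENTENCES `priceA ∕ priceB` (the `_rel` END
`RealisedEndRelPDWTL.hybridNE7_of_realisedDomainsRunW_printedT3bPDTL_rel`'s `hPq ∕ hPq′` at the tower, `κ := costT`) ADDED next to the
extraction displays `extractA ∕ extractB` (its `fibM ∕ fibM′`); every other field verbatim. [folklore] -/
structure TowerExtractionPricedDataLWR (D : FiniteEpsData F G) (C : T4PrintedShapeBanking.Consts) (O : PrintedO1s) (θv : ℝ)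
    (rr d n : ℕ) (hn : 0 < n) (g₀ : ℕ → ℝ) (os : List (ULoop F))
    (cΛ M Φ β₀ : ℝ) (p₁ η η' κ κ₂ κᵥ : ℕ)
    (P : Type) [DecidableEq P] (X : ℕ → ℕ → Type) (𝒢 : (K j : ℕ) → GoodClass (X K j))
    [∀ K, MeasurableSpace (X K K)] (μ : (K : ℕ) → Measure (X K K)) [∀ K, IsFiniteMeasure (μ K)] where
  /-- the source radius -/
  l₀ : ℝ
  /-- the volume factor of the matching remainders -/
  vol : ℝ
  /-- the source radius is positive -/
  l₀_pos : 0 < l₀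
  /-- the volume factor is positive -/
  vol_pos : 0 < vol
  /-- the threshold in the number of steps -/
  K₀ : ℕ
  /-- THE TOWER of run A: per cutoff `K`, `K` one-step positive operations branching over the choices (IR-97-2), READ AT PRINT's LIVE
  INDEX (C-ρ-TOWER: second-group 𝐑-outputs and healings inside `op j g p`, (1.98) ∕ (1.101)) -/
  T : (K : ℕ) → Tower P (X K) (𝒢 K)
  /-- the small-field choice at every step of every run -/
  p₀ : ℕ → ℕ → P
  /-- the small-field choice lies on every branch -/
  hp₀ : ∀ K j g, p₀ K j ∈ (T K).branch j g
  /-- the dressed initial densities `ρ₀ K t` (H2's `e^{t·obs}·ρ₀`) -/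
  ρ₀ : (K : ℕ) → ℝ → X K 0 → ℝ
  /-- the dressed initial densities are good -/
  hρ₀ : ∀ K t, (𝒢 K 0).Gd (ρ₀ K t)
  /-- the dressed initial densities are non-negative -/
  h0 : ∀ K t x, 0 ≤ ρ₀ K t x
  /-- display (integrability of the elementary terms of the tower's operations, representation letter `1`) -/
  intA : ∀ K t a, ∀ ι ∈ (skelFam T p₀ K).LIdx a,
    Integrable ((reprFam T p₀ ρ₀ hρ₀ h0 (fun _ _ => 1) (fun _ _ => one_pos) K t).eterm a ι) (μ K)
  /-- display (H2: the dressed push-forward identity, at the tower's final density `densFam`) -/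
  H2A : ∀ K t, |t| ≤ l₀ → K₀ ≤ K →
    ∫ U, Real.exp (t * T4GenFunBounds.prodObs (D.scheme g₀) K os U) * D.dens K (g₀ K) 0 U ∂fieldMeasure (F.P K) 0 G =
      ∫ x, densFam T ρ₀ K t x ∂μ K
  /-- THE STEP READING of the tower's choices (regions, cubes, classes; flow, memory — IR-99-3) -/
  𝒮 : StepReading P d
  /-- (c1) the reading's blocking parameter is the family's -/
  hL : 𝒮.L = F.L
  /-- (c1) the reading's exponent profile is the run's own -/
  hs : 𝒮.s = runProfile F.L 𝒮.R
  /-- the small-field choice names no region -/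
  hν0 : ∀ K j g, 𝒮.ν K j g (p₀ K j) = ∅
  /-- named regions are pointed, face-connected and of tree length at most their class -/
  hν : ∀ K j g p, ∀ nr ∈ 𝒮.ν K j g p, nr.1 ∈ nr.2 ∧ FaceConnected nr.2 ∧ treeLen nr.2 ≤ 𝒮.κ K nr
  /-- flow: memory domination -/
  hRm : ∀ K s k, 𝒮.Rm K s k ≤ 𝒮.R K s
  /-- flow: memory domination, one-step form -/
  hRmS : ∀ K, K₀ ≤ K → ∀ t k, 𝒮.Rm K t (k + 1) ≤ 𝒮.R K (t + 1)
  /-- flow: non-degenerate memory -/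
  hRm2 : ∀ K, K₀ ≤ K → ∀ t, 2 ≤ 𝒮.Rm K t 1
  /-- PRINT-SIDE STEP DATA: print's constants record ([B16] pp. 380–383's O(1)s, `B16StepFactorsPrinted.Consts`) -/
  c : B16StepFactorsPrinted.Consts
  /-- PRINT-SIDE STEP DATA: print's abstract per-step carriers (J4-a `StepData`) per run `K`, step `j`, prefix `g` -/
  Xs : (K j : ℕ) → (Fin j → P) → StepData d P
  /-- C-side (3R-range): print's p. 380 chain constants are non-negative and within the volume letter's constant -/
  (hC' : 0 ≤ c.C') (hC380 : 0 ≤ c.C380) (hcΛc : c.C' + c.C380 ≤ cΛ)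
  /-- flow (3R-range): `1 ≤ ℓ_{j+1}` on the performed range (couplings at most `e^{-1/2}`) -/
  hℓ1 : ∀ K, K₀ ≤ K → ∀ j, j < K → 1 ≤ ell (gsOf D g₀ K) (j + 1)
  /-- tower-side display (β) (J4.2's `hβ`): PAST THE CUTOFF the step maps kill the unit — the natural padding of a `K`-step run -/
  hβ : ∀ K, K₀ ≤ K → ∀ j, K ≤ j → ∀ (g : Fin j → P) (p : P) (x : X K (j + 1)), ((T K).op j g p).T (fun _ => 1) x = 0
  /-- display: PRINT's PER-STEP SENTENCES `StepDisplaysAt` (IR-100-2, all five conjuncts — the ROUNDED (P) included) AT THE CARRIERS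
  READ OFF THE TOWER AND THE PROCESS (`carriersOf`), every run `K ≥ K₀`, PERFORMED step `j < K`, prefix `g` — J4.2's binder verbatim -/
  hdisp : ∀ K, K₀ ≤ K → ∀ j, j < K → ∀ (g : Fin j → P),
    StepDisplaysAt (runsOf D g₀ K) j (carriersOf T 𝒮 (runsOf D g₀ K) K j g (Xs K j g)) c
  /-- display: the `=` CLASS JUNCTION on the performed range (J4.2's `hclass`) -/
  hclass : ∀ K, K₀ ≤ K → ∀ j, j < K → ∀ (g : Fin j → P) (p : P),
    ∀ x ∈ (𝒮.runPartial K (j + 1) (Fin.snoc g p)).histM.newPairs (j + 1),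
      (Xs K j g).dC p x = (𝒮.κ K ((𝒮.runPartial K (j + 1) (Fin.snoc g p)).histM.newAt (j + 1) x) : ℝ)
  /-- display: p. 380's chain, FIRST LINK — the region volume is at most the large-field volume (3R-range's `hΩ`) -/
  hΩ : ∀ K, K₀ ≤ K → ∀ j, j < K → ∀ (g : Fin j → P) (p : P), (Xs K j g).volZΩ p ≤ (Xs K j g).volZ p
  /-- display: p. 380's chain in CUBE-COUNT form — the large-field volume is at most `(M·R_{j+1})^d` per component cube (3R-range's `hcube`) -/
  hcube : ∀ K, K₀ ≤ K → ∀ j, j < K → ∀ (g : Fin j → P) (p : P),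
    (Xs K j g).volZ p ≤
      (M * 𝒮.R K (j + 1)) ^ d * ∑ cc ∈ (𝒮.runPartial K (j + 1) (Fin.snoc g p)).histM.comp (j + 1), ((cc.2).card : ℝ)
  /-- letter table (3R): print's constants record carries the cell's dimension -/
  hd : c.d = O.d
  /-- letter table (3R, (2.5)): print's size profile AT the run's couplings IS the reading's sizes -/
  hR : ∀ K h, c.R (gsOf D g₀ K h) = (𝒮.R K h : ℝ)
  /-- letter table (3R): print's `p₁`-profile is `ℓ^{p₁}` -/
  hP : ∀ K h, c.P1 (gsOf D g₀ K h) = ell (gsOf D g₀ K) h ^ p₁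
  /-- display (2.5): the reading's sizes are admissible for the running couplings -/
  isRj : ∀ K s, s ≤ K → B14.IsRj F.L rr ((D.C ⟨K, F.m, g₀ K⟩).flow.g s) (𝒮.R K s)
  /-- sizes are at least one -/
  one_le_R : ∀ K, K₀ ≤ K → ∀ t, 1 ≤ 𝒮.R K t
  /-- flow (K): the blocking parameter is at least four -/
  hL4 : 4 ≤ F.L
  /-- flow (K): the run's own exponent profile is non-increasing within the run -/
  hprof : ∀ K, K₀ ≤ K → ∀ t, t < K → runProfile F.L 𝒮.R K (t + 1) ≤ runProfile F.L 𝒮.R K t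
  /-- flow (K): drop control of the run's own profile -/
  hdrop : ∀ K, K₀ ≤ K → ∀ m, DropCtl (runProfile F.L 𝒮.R K) m
  /-- pass-V input condition per term: disjoint new regions -/
  hD : ∀ K, K₀ ≤ K → ∀ τ ∈ HIndex.termSet (skelFam T p₀) K, ((𝒮.reading T p₀).inputOf.run K τ).NewDisjoint
  /-- pass-V input condition per term: every new region lies in the torus' period box at its level -/
  hreg : ∀ K, K₀ ≤ K → ∀ τ ∈ HIndex.termSet (skelFam T p₀) K, ((𝒮.reading T p₀).inputOf.run K τ).RegionsInBox n K
  /-- constants: the window constant -/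
  hn₁ : 13 ≤ C.n₁
  /-- constants -/
  hE₂ : 0 < C.E₂
  /-- constants — `E₃` strictly positive -/
  hE₃pos : 0 < C.E₃
  /-- (2.9)∕(2.7)'s letter `β′` -/
  β' : ℝ
  /-- display (2.9) on the reading's sizes -/
  h29 : ∀ K, K₀ ≤ K → B14FlowStep.FlowIneq29 (𝒮.R K) (D.C ⟨K, F.m, g₀ K⟩).flow.g F.L β' β₀ K
  /-- C-side: print's p. 380 volume constant is nonnegative -/
  hcΛ : 0 ≤ cΛ
  /-- C-side: the cube-side letter `M` of the lattice volume letter is nonnegative -/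
  hMΛ : 0 ≤ M
  /-- flow (ADDED): `0 ≤ ℓ_j = log (g^K_j)⁻²` on every run's performed range (couplings at most one) -/
  hℓ : ∀ K j, j ≤ K → 0 ≤ ell (gsOf D g₀ K) j
  /-- RUN B = THE SAME FAMILY AT CUTOFF `K + 1` (S, NODE O): the truncation of the cutoff-`(K+1)` tower's level-`(K+1)` terms onto
  the cutoff-`K` tower's index -/
  trunc : ℕ → HIndex.Idx (skelFam T p₀) → HIndex.Idx (skelFam T p₀)
  /-- display (S): the truncation maps run B's term set into run A's -/
  htr : ∀ K, K₀ ≤ K → ∀ τ' ∈ HIndex.termSet (skelFam T p₀) (K + 1), trunc K τ' ∈ HIndex.termSet (skelFam T p₀) K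
  /-- THE QUOTIENTS of run A: per cutoff and pinned old genealogy (key), source-uniform -/
  qA : ℕ → Finset ((Fin d → ℕ) × Gen PEv × Multiset (PEv × ((Fin d → ℕ) × Finset (Pt d)))) → ℝ
  /-- THE QUOTIENTS of run B, at run A's keys -/
  qB : ℕ → Finset ((Fin d → ℕ) × Gen PEv × Multiset (PEv × ((Fin d → ℕ) × Finset (Pt d)))) → ℝ
  /-- the quotients of run A are non-negative on the bad keys of the window -/
  qA_nonneg : ∀ K, K₀ ≤ K →
    ∀ k ∈ badGMems (memA n F.L (𝒮.reading T p₀)) jhalf (HIndex.termSet (skelFam T p₀))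
        (kmemA n F.L hn (lt_of_lt_of_le (by norm_num) (two_le_L F)) (𝒮.reading T p₀)) K, 0 ≤ qA K k
  /-- the quotients of run B are non-negative on the bad keys of the window -/
  qB_nonneg : ∀ K, K₀ ≤ K →
    ∀ k ∈ badGMems (memA n F.L (𝒮.reading T p₀)) jhalf (HIndex.termSet (skelFam T p₀))
        (kmemA n F.L hn (lt_of_lt_of_le (by norm_num) (two_le_L F)) (𝒮.reading T p₀)) K, 0 ≤ qB K k
  /-- **THE EXTRACTION DISPLAY, run A** (`PinnedExtraction.ExtractionLaws.extract` at the tower's keys; the (A1c) instance OWES it — print's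
  KIND, [Balaban1989LargeFieldII] (1.79)–(1.89) + Thm 1's upper half with the pinned genealogy's operations replaced by their bounds, over
  the SAME run's full sum; NOT print's statement): on the window, the partial sum of M2-A's weights over the fibre of a bad key is at most
  `qA K k` times the full sum -/
  extractA : ∀ K t, |t| ≤ l₀ → K₀ ≤ K →
    ∀ k ∈ badGMems (memA n F.L (𝒮.reading T p₀)) jhalf (HIndex.termSet (skelFam T p₀))
        (kmemA n F.L hn (lt_of_lt_of_le (by norm_num) (two_le_L F)) (𝒮.reading T p₀)) K,
      ∑ τ ∈ fibre (kmemA n F.L hn (lt_of_lt_of_le (by norm_num) (two_le_L F)) (𝒮.reading T p₀))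
          (HIndex.termSet (skelFam T p₀)) K k,
        Repr172R.weight μ (reprFam T p₀ ρ₀ hρ₀ h0 (fun _ _ => 1) (fun _ _ => one_pos)) t τ ≤
      qA K k * ∑ τ ∈ HIndex.termSet (skelFam T p₀) K, Repr172R.weight μ (reprFam T p₀ ρ₀ hρ₀ h0 (fun _ _ => 1) (fun _ _ => one_pos)) t τ
  /-- **THE EXTRACTION DISPLAY, run B = the family at cutoff `K + 1`, THROUGH `trunc` ONTO RUN A's KEYS**: on the window, the partial sum of
  run B's weights over its terms truncating into the fibre of a bad key is at most `qB K k` times run B's full sum -/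
  extractB : ∀ K t, |t| ≤ l₀ → K₀ ≤ K →
    ∀ k ∈ badGMems (memA n F.L (𝒮.reading T p₀)) jhalf (HIndex.termSet (skelFam T p₀))
        (kmemA n F.L hn (lt_of_lt_of_le (by norm_num) (two_le_L F)) (𝒮.reading T p₀)) K,
      ∑ τ' ∈ (HIndex.termSet (skelFam T p₀) (K + 1)).filter (fun τ' =>
          trunc K τ' ∈ fibre (kmemA n F.L hn (lt_of_lt_of_le (by norm_num) (two_le_L F)) (𝒮.reading T p₀))
            (HIndex.termSet (skelFam T p₀)) K k),
        Repr172R.weight μ (reprFam T p₀ ρ₀ hρ₀ h0 (fun _ _ => 1) (fun _ _ => one_pos)) t τ' ≤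
      qB K k * ∑ τ' ∈ HIndex.termSet (skelFam T p₀) (K + 1),
        Repr172R.weight μ (reprFam T p₀ ρ₀ hρ₀ h0 (fun _ _ => 1) (fun _ _ => one_pos)) t τ'
  /-- **THE PRICE SENTENCE, run A** (IR-103-2 «count DERIVED»: the `_rel` END's `hPq` at the tower, `κ := costT`; the (A1c) instance OWES
  it together with `extractA` — print's KIND, [Balaban1989LargeFieldII] Thm 1's upper half (1.79)–(1.89) read per pinned old genealogy:
  «the relative weight of a pinned live key family is at most its PRINTED PRICE»; NOT print's statement): on the window, for every bad term,
  the quotient of its key is at most the product over its named members of print's shape price at the model's total life cost, discounted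
  by the allowance `exp (−(8∕E₂ · totalCostT + 4 · partnerAges))` -/
  priceA : ∀ K t, |t| ≤ l₀ → K₀ ≤ K →
    ∀ τ ∈ badTerms (memA n F.L (𝒮.reading T p₀)) jhalf (HIndex.termSet (skelFam T p₀)) K,
      qA K (kmemA n F.L hn (lt_of_lt_of_le (by norm_num) (two_le_L F)) (𝒮.reading T p₀) K τ) ≤
        ∏ q ∈ memA n F.L (𝒮.reading T p₀) K τ,
          pshapeTH Prod.fst O C 1 1 (𝒮.R K) (D.C ⟨K, F.m, g₀ K⟩).flow.g 0 (costT Prod.fst C K (𝒮.R K)) q.2 *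
            Real.exp (-(8 / C.E₂ * totalCostT Prod.fst C K (𝒮.R K) q.2 + 4 * (partnerAges (PEv.step ∘ Prod.fst) q.2 : ℝ)))
  /-- **THE PRICE SENTENCE, run B** (the `_rel` END's `hPq′` at the tower, at run A's keys and members, `κ′ := costT`) -/
  priceB : ∀ K t, |t| ≤ l₀ → K₀ ≤ K →
    ∀ τ ∈ badTerms (memA n F.L (𝒮.reading T p₀)) jhalf (HIndex.termSet (skelFam T p₀)) K,
      qB K (kmemA n F.L hn (lt_of_lt_of_le (by norm_num) (two_le_L F)) (𝒮.reading T p₀) K τ) ≤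
        ∏ q ∈ memA n F.L (𝒮.reading T p₀) K τ,
          pshapeTH Prod.fst O C 1 1 (𝒮.R K) (D.C ⟨K, F.m, g₀ K⟩).flow.g 0 (costT Prod.fst C K (𝒮.R K)) q.2 *
            Real.exp (-(8 / C.E₂ * totalCostT Prod.fst C K (𝒮.R K) q.2 + 4 * (partnerAges (PEv.step ∘ Prod.fst) q.2 : ℝ)))
  /-- NE7c: the two runs' shell parts -/
  (shA shB : ℕ → ℝ → HIndex.Idx (skelFam T p₀) → ℝ)
  /-- NE7c's shell weight budget -/
  Wsh : ℕ → ℝ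
  /-- NE7c (S): the indicator shells' relative weight bound over the tower's terms -/
  shell : ShellWeightBound l₀ (HIndex.termSet (skelFam T p₀))
    (fun _ t => Repr172R.weight μ (reprFam T p₀ ρ₀ hρ₀ h0 (fun _ _ => 1) (fun _ _ => one_pos)) t)
    (weightB μ (reprFam T p₀ ρ₀ hρ₀ h0 (fun _ _ => 1) (fun _ _ => one_pos)) trunc) shA shB Wsh
  /-- NE7 core budget data -/
  (Cc Rr CcRec RrRec : ℕ → ℝ → HIndex.Idx (skelFam T p₀) → ℝ)
  /-- NE7 core budget rates -/
  (ν u s₂ q₀ r s : ℕ → ℝ)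
  /-- NE7 (S): the re-indexed per-term budget over the tower reading's bad classes -/
  budget : ReindexedBudget l₀ vol (HIndex.termSet (skelFam T p₀))
    (fun K t τ => Repr172R.weight μ (reprFam T p₀ ρ₀ hρ₀ h0 (fun _ _ => 1) (fun _ _ => one_pos)) t τ - shA K t τ)
    (fun K t τ => weightB μ (reprFam T p₀ ρ₀ hρ₀ h0 (fun _ _ => 1) (fun _ _ => one_pos)) trunc K t τ - shB K t τ)
    (badOfClass (bstrOf Prod.fst (memA n F.L (𝒮.reading T p₀))) (HIndex.termSet (skelFam T p₀))
      (fun K _ => badClasses Prod.fst (memA n F.L (𝒮.reading T p₀)) jhalf (HIndex.termSet (skelFam T p₀)) K))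
    Cc Rr CcRec RrRec ν u s₂ q₀ r s
  /-- summable rates -/
  (sum_r : Summable r) (sum_u : Summable u) (sum_s : Summable s) (sum_s₂ : Summable s₂)
  /-- C-side signs: the volume slack is positive; `β₀, Φ ≥ 0` -/
  (hθv : 0 < θv) (hβ₀ : 0 ≤ β₀) (hΦ : 0 ≤ Φ)
  /-- C-side: the birth-floor mass letter -/
  m : ℝ
  /-- C-side: `A₁² ≤ m` -/
  hm : O.A₁ ^ 2 ≤ m
  /-- census identity AT PRINT's `t = d+5` ([B16] p. 383 «we assume that 2p₁ − (d+5)r₀ > p₀», the gap named `η`) -/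
  hexpR : C.p₀ + rr * (O.d + 5) + η = 2 * p₁
  /-- census identity: `r(q′+1) + r(d+5) + η′ = 2p₁` -/
  hexpR' : rr * (C.q' + 1) + rr * (O.d + 5) + η' = 2 * p₁
  /-- census identity: `r(q′+1) + κ = 2p₀` -/
  hexpB : rr * (C.q' + 1) + κ = 2 * C.p₀
  /-- census identity in LATTICE units: `1 + κ₂ = r·(q′ − d)` -/
  hexpFL : 1 + κ₂ = rr * (C.q' - d)
  /-- census side condition in LATTICE units: `d ≤ q′` -/
  hdq : d ≤ C.q'
  /-- census identity in LATTICE units: `1 + r·d + κᵥ = 2p₀` -/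
  hexpVL : 1 + rr * d + κᵥ = 2 * C.p₀
  /-- exponent gaps -/
  (hη : 1 ≤ η) (hη' : 1 ≤ η') (hκ : 1 ≤ κ) (hκ₂ : 1 ≤ κ₂) (hκᵥ : 1 ≤ κᵥ)
  /-- constants: `1 ≤ p₀` -/
  hp₀c : 1 ≤ C.p₀
  /-- signs of print's O(1)s -/
  (hγ₀ : 0 < O.γ₀) (hA₁ : O.A₁ ≠ 0) (hA₀ : 0 < C.A₀) (hM : 0 < O.M)
  /-- letter table (part 3 `hsB_of_tables`): print's `γ₀` is the count road's -/
  hγc : c.γ₀ = O.γ₀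
  /-- letter table (part 3): print's `A₀` is the count road's -/
  hAc : c.A₀ = C.A₀
  /-- letter table (part 3): print's `p₀` is the count road's -/
  hpc : c.p₀ = C.p₀
  /-- letter table (part 3): the birth-floor mass letter is at most print's p. 381 min-constant `min{½B₃⁻²A₀², 2A₁², A₁²}` -/
  hmc : m ≤ minConst c.B₃ c.A₀ c.A₁
  /-- (2.7)'s power (NE7-rate row) -/
  p27 : ℕ
  /-- (2.7)'s power is at least one -/
  hp27 : 1 ≤ p27
  /-- display (2.7) per cutoff on the run's couplings -/
  h27 : ∀ K, K₀ ≤ K → B14.FlowIneq27 (D.C ⟨K, F.m, g₀ K⟩).flow.g β' β₀ p27 K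

end Data

end

end Summit.QuantumFields.BalabanUV.T4Continuum.B16HistoryTowerExtractionPricedDataLWR
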